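import Mathlib
import Summits.ValiantsHypothesis.ValiantsHypothesis.Theses.ForgivenCollisions
import Summits.ValiantsHypothesis.ValiantsHypothesis.Theorems.ForgivenCollisionsGradedToUniform
import Literature.Computability.AlgebraicComplexity.CosetComplexity
import Literature.Computability.AlgebraicComplexity.CircuitDepth

/-!
# GradedLaw — crux-strategist census artefacts (planner, unit cstrat-stmt-ValiantsHypothesis-11562-r1, 2026-08-17)

Typed companion of `Cruxes/GradedLaw/STRATEGY-CENSUS.md` for the crux
`Summit.ValiantsHypothesis.ValiantsHypothesis.Theses.ForgivenCollisions.GradedLaw` (item stmt-ValiantsHypothesis-11562: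
`∃ γ > 0, ∀ r ≥ 1, ∃ n₀, ∀ n ≥ n₀, n^(γ·r) ≤ κ_r(n)`, `κ_r(n) = cosetComplexity (J_r n) per_n`).

* `## AtLeastSummit` — C → S is a THEOREM of the tree: `gradedLaw_implies_summit` (via the landed
  `Theorems.gradedToUniform_proof` and the assembly argument of `ForgivenCollisions.closes`). So the crux is not weaker
  than the Statement.
* `## Negation` — the crux is FALSE on paper (census §1, walk-exponential formula, three independent machine checks):
  `PolyModTriples` (the coset of `per_n` modulo TRIPLED LINES ONLY has representatives of polynomial circuit size) is the
  single formal target; from it `¬ GradedLaw`, `¬ UniformLaw` (the route target) and `¬ X∞` follow by the bookkeeping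
  PROVED below (`not_gradedLaw_of_polyModTriples`, `not_uniformLaw_of_polyModTriples`). The explicit representative
  `walkRep r n` (degree-`n` part of `exp(S + E_r)`, `E_r` = `O(r)` walk polynomials) is typed; its two properties
  `WalkRepMem` / `WalkRepCost` are the statements a Theorems file has to prove (refuter/prover work; planners do not prove).
* `## Decomposition` / `## Strengthen` — typed candidates discussed in the census (elaboration only).

Nothing here is a route item.
-/

set_option linter.dupNamespace false
set_option linter.unusedVariables false

noncomputable section

open MvPolynomial Literature.Computability.AlgebraicComplexity

namespace Summit.ValiantsHypothesis.ValiantsHypothesis.Cruxes.GradedLaw.Census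

open Summit.ValiantsHypothesis.ValiantsHypothesis.Theses.ForgivenCollisions
  (GradedLaw UniformLaw GradedToUniform FirstRung)

/-! ## The objects -/

/-- The Bad_r exponent set: a tripled line, or at least `r` doubled lines (verbatim from the route file). -/
abbrev Bad (r n : ℕ) : Set (Fin n × Fin n →₀ ℕ) :=
  {d | ((∃ i : Fin n, 3 ≤ rowCount d i) ∨ (∃ j : Fin n, 3 ≤ colCount d j) ∨
      r ≤ (Finset.univ.filter fun i : Fin n => 2 ≤ rowCount d i).card +
        (Finset.univ.filter fun j : Fin n => 2 ≤ colCount d j).card)}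

/-- The collision ideal `J_r(n)` — verbatim the ideal inside `GradedLaw` / `UniformLaw` / `FirstRung`. -/
abbrev J (r n : ℕ) : Ideal (MvPolynomial (Fin n × Fin n) ℂ) :=
  Ideal.span ((fun d : Fin n × Fin n →₀ ℕ => MvPolynomial.monomial d (1 : ℂ)) '' Bad r n)

/-- Tripled lines only: `J_∞(n)` (the route header's "single-coset endpoint X∞" ideal). -/
abbrev BadInf (n : ℕ) : Set (Fin n × Fin n →₀ ℕ) :=
  {d | (∃ i : Fin n, 3 ≤ rowCount d i) ∨ (∃ j : Fin n, 3 ≤ colCount d j)}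

/-- `J_∞(n)`. -/
abbrev Jinf (n : ℕ) : Ideal (MvPolynomial (Fin n × Fin n) ℂ) :=
  Ideal.span ((fun d : Fin n × Fin n →₀ ℕ => MvPolynomial.monomial d (1 : ℂ)) '' BadInf n)

/-- `κ_r(n)`. -/
abbrev κ (r n : ℕ) : ℕ := cosetComplexity (J r n) (perPoly (Fin n) ℂ)

/-- `κ_∞(n)`. -/
abbrev κinf (n : ℕ) : ℕ := cosetComplexity (Jinf n) (perPoly (Fin n) ℂ)

/-- Read-back: `GradedLaw` is literally `∃ γ > 0, ∀ r ≥ 1, ∃ n₀, ∀ n ≥ n₀, n^(γ r) ≤ κ_r(n)`. -/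
theorem gradedLaw_iff :
    GradedLaw ↔ ∃ γ : ℝ, 0 < γ ∧ ∀ r : ℕ, 1 ≤ r → ∃ n₀ : ℕ, ∀ n : ℕ, n₀ ≤ n →
      (n : ℝ) ^ (γ * r) ≤ ((κ r n : ℕ) : ℝ) :=
  Iff.rfl

/-- Read-back: `UniformLaw` is literally `∀ c, ∃ r n₀, ∀ n ≥ n₀, n^c + c < κ_r(n)`. -/
theorem uniformLaw_iff :
    UniformLaw ↔ ∀ c : ℕ, ∃ r n₀ : ℕ, ∀ n : ℕ, n₀ ≤ n → n ^ c + c < κ r n :=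
  Iff.rfl

/-- The route header's fallback target X∞: "per_n + J_∞ has no p-bounded members". (Not a filed item; typed here
because the negation below kills it too.) -/
def XInfinity : Prop := ¬ ∃ c : ℕ, ∀ n : ℕ, κinf n ≤ n ^ c + c

/-! ## AtLeastSummit: C → S is a theorem of the tree -/

/-- `UniformLaw → VH`: the assembly argument of `ForgivenCollisions.closes` without its decorative binders. -/
theorem uniformLaw_implies_summit : UniformLaw → ValiantsHypothesis := by
  intro hX
  refine Summit.ValiantsHypothesis.Hub.valiantsHypothesis_of_not_isVPFamily_per ?_
    (Literature.Computability.AlgebraicComplexity.mem_VP_ofFintype_iff_holds _)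
    (Literature.Computability.AlgebraicComplexity.perFamily_mem_VNP_holds ℂ)
  rintro ⟨-, c, hc⟩
  obtain ⟨r, n₀, h⟩ := hX c
  exact absurd (hc n₀) (not_le.2 (lt_of_lt_of_le (h n₀ le_rfl)
    (Literature.Computability.AlgebraicComplexity.cosetComplexity_le_complexity _ _)))

/-- **The crux is at least the summit**: `GradedLaw → VH`, by the LANDED support
`Theorems.gradedToUniform_proof : GradedLaw → UniformLaw` and the assembly argument. This is the theorem that makes the
BC2 probe "C → S" succeed in substance (the cheap battery with Statement-only imports cannot see it). -/
theorem gradedLaw_implies_summit : GradedLaw → ValiantsHypothesis := fun h =>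
  uniformLaw_implies_summit (Summit.ValiantsHypothesis.ValiantsHypothesis.Theorems.gradedToUniform_proof h)

/-! ## Monotonicity of the ladder -/

theorem bad_anti {r r' n : ℕ} (h : r ≤ r') : Bad r' n ⊆ Bad r n := by
  intro d hd
  rcases hd with h1 | h2 | h3
  · exact Or.inl h1
  · exact Or.inr (Or.inl h2)
  · exact Or.inr (Or.inr (le_trans h h3))

theorem badInf_subset_bad (r n : ℕ) : BadInf n ⊆ Bad r n := by
  intro d hd
  rcases hd with h1 | h2
  · exact Or.inl h1
  · exact Or.inr (Or.inl h2)

/-- More than `2n` doubled lines do not exist: `Bad r n = BadInf n` for `r ≥ 2n+1`. -/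
theorem bad_eq_badInf {r n : ℕ} (hr : 2 * n + 1 ≤ r) : Bad r n = BadInf n := by
  refine Set.Subset.antisymm ?_ (badInf_subset_bad r n)
  intro d hd
  rcases hd with h1 | h2 | h3
  · exact Or.inl h1
  · exact Or.inr h2
  · exfalso
    have ha : (Finset.univ.filter fun i : Fin n => 2 ≤ rowCount d i).card ≤ n :=
      (Finset.card_filter_le _ _).trans (by simp)
    have hb : (Finset.univ.filter fun j : Fin n => 2 ≤ colCount d j).card ≤ n :=
      (Finset.card_filter_le _ _).trans (by simp)
    omega

theorem J_anti {r r' : ℕ} (n : ℕ) (h : r ≤ r') : J r' n ≤ J r n :=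
  Ideal.span_mono (Set.image_mono (bad_anti h))

theorem Jinf_le_J (r n : ℕ) : Jinf n ≤ J r n :=
  Ideal.span_mono (Set.image_mono (badInf_subset_bad r n))

theorem J_eq_Jinf {r n : ℕ} (hr : 2 * n + 1 ≤ r) : J r n = Jinf n := by
  simp only [J, Jinf, bad_eq_badInf hr]

/-- `κ_r(n)` is monotone in `r`. -/
theorem κ_mono {r r' : ℕ} (n : ℕ) (h : r ≤ r') : κ r n ≤ κ r' n :=
  cosetComplexity_anti (J_anti n h) _

/-- Every rung lies below the endpoint: `κ_r(n) ≤ κ_∞(n)`. -/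
theorem κ_le_κinf (r n : ℕ) : κ r n ≤ κinf n :=
  cosetComplexity_anti (Jinf_le_J r n) _

/-- The endpoint is a rung: `κ_(2n+1)(n) = κ_∞(n)`. -/
theorem κ_eq_κinf (n : ℕ) : κ (2 * n + 1) n = κinf n := by
  simp only [κ, κinf, J_eq_Jinf (le_refl (2 * n + 1))]

/-! ## Negation: statements and the proved bookkeeping -/

/-- NEGATION TARGET (the one statement to land): the coset of `per_n` modulo tripled lines has representatives of
polynomial circuit size, `κ_∞(n) ≤ C·(n+1)^c`. TRUE on paper: the walk-exponential formula (census §1) gives an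
explicit representative of size `O(n^6)` (crude) — `walkRep (2n+1) n` below. -/
def PolyModTriples : Prop := ∃ c C : ℕ, ∀ n : ℕ, κinf n ≤ C * (n + 1) ^ c

/-- Fixed-exponent form along the ladder: every rung is `O(n^c)` with the SAME `c`. (For `c = 3` this is the refuter's
"κ_r(n) ≤ C_r n³ for every fixed r"; `PolyModTriples` gives it with a uniform constant.) -/
def FixedExponentBound (c : ℕ) : Prop := ∀ r : ℕ, ∃ n₁ : ℕ, ∀ n : ℕ, n₁ ≤ n → κ r n ≤ n ^ c

/-- Absorbing the constant: `C·(n+1)^c ≤ n^(c+1)` for `n ≥ 2^c·C`, so `PolyModTriples` gives a fixed exponent on the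
whole ladder. -/
theorem fixedExponent_of_polyModTriples (h : PolyModTriples) : ∃ c, FixedExponentBound c := by
  obtain ⟨c, C, hC⟩ := h
  refine ⟨c + 1, fun r => ⟨2 ^ c * C + 1, fun n hn => ?_⟩⟩
  have h1 : κ r n ≤ C * (n + 1) ^ c := (κ_le_κinf r n).trans (hC n)
  have h2 : (n + 1) ^ c ≤ 2 ^ c * n ^ c := by
    rw [← mul_pow]; exact Nat.pow_le_pow_left (by omega) c
  have h3 : C * (2 ^ c * n ^ c) ≤ n * n ^ c := by
    have h4 : C * 2 ^ c ≤ n := by rw [mul_comm]; omega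
    rw [← mul_assoc]; exact Nat.mul_le_mul_right _ h4
  calc κ r n ≤ C * (n + 1) ^ c := h1
    _ ≤ C * (2 ^ c * n ^ c) := Nat.mul_le_mul_left _ h2
    _ ≤ n * n ^ c := h3
    _ = n ^ (c + 1) := by ring

/-- A fixed exponent on the ladder refutes the GRADED law: take `r` with `γ·r ≥ c + 1`. -/
theorem not_gradedLaw_of_fixedExponent {c : ℕ} (h : FixedExponentBound c) : ¬ GradedLaw := by
  rintro ⟨γ, hγ, hG⟩
  obtain ⟨m, hm⟩ := exists_nat_ge (((c : ℝ) + 1) / γ)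
  rw [div_le_iff₀ hγ] at hm
  have hγr : ((c : ℝ) + 1) ≤ γ * ((m + 1 : ℕ) : ℝ) := by push_cast; nlinarith
  obtain ⟨n₀, hn₀⟩ := hG (m + 1) (by omega)
  obtain ⟨n₁, hn₁⟩ := h (m + 1)
  set n : ℕ := max (max n₀ n₁) 2 with hn
  have hA : (n : ℝ) ^ (γ * ((m + 1 : ℕ) : ℝ)) ≤ ((κ (m + 1) n : ℕ) : ℝ) :=
    hn₀ n (le_trans (le_max_left _ _) (le_max_left _ _))
  have hB : ((κ (m + 1) n : ℕ) : ℝ) ≤ ((n ^ c : ℕ) : ℝ) := by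
    exact_mod_cast hn₁ n (le_trans (le_max_right _ _) (le_max_left _ _))
  have hn2 : (2 : ℕ) ≤ n := le_max_right _ _
  have hlt : ((n ^ c : ℕ) : ℝ) < ((n ^ (c + 1) : ℕ) : ℝ) := by
    exact_mod_cast Nat.pow_lt_pow_right (by omega) (by omega)
  have hpow : ((n ^ (c + 1) : ℕ) : ℝ) ≤ (n : ℝ) ^ (γ * ((m + 1 : ℕ) : ℝ)) := by
    rw [Nat.cast_pow, ← Real.rpow_natCast]
    apply Real.rpow_le_rpow_of_exponent_le
    · exact_mod_cast (show 1 ≤ n by omega)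
    · push_cast at hγr ⊢; linarith
  linarith

/-- A fixed exponent on the ladder refutes the UNIFORM law (the route target) at `c`. -/
theorem not_uniformLaw_of_fixedExponent {c : ℕ} (h : FixedExponentBound c) : ¬ UniformLaw := by
  intro hU
  obtain ⟨r, n₀, hr⟩ := hU c
  obtain ⟨n₁, hn₁⟩ := h r
  have h1 : (max n₀ n₁) ^ c + c < κ r (max n₀ n₁) := hr (max n₀ n₁) (le_max_left _ _)
  have h2 : κ r (max n₀ n₁) ≤ (max n₀ n₁) ^ c := hn₁ (max n₀ n₁) (le_max_right _ _)
  omega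

/-- A polynomial endpoint refutes X∞ directly (constants absorbed: small `n` by a constant, large `n` by one more
power). -/
theorem not_xInfinity_of_polyModTriples (h : PolyModTriples) : ¬ XInfinity := by
  intro hX
  apply hX
  obtain ⟨c', C, hC⟩ := h
  refine ⟨max (c' + 1) (C * (2 ^ c' * C + 2) ^ c'), fun n => ?_⟩
  rcases lt_or_ge n (2 ^ c' * C + 1) with hlt | hge
  · have h1 : κinf n ≤ C * (2 ^ c' * C + 2) ^ c' :=
      (hC n).trans (Nat.mul_le_mul_left _ (Nat.pow_le_pow_left (by omega) _))
    calc κinf n ≤ C * (2 ^ c' * C + 2) ^ c' := h1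
      _ ≤ max (c' + 1) (C * (2 ^ c' * C + 2) ^ c') := le_max_right _ _
      _ ≤ n ^ max (c' + 1) (C * (2 ^ c' * C + 2) ^ c') + max (c' + 1) (C * (2 ^ c' * C + 2) ^ c') :=
          Nat.le_add_left _ _
  · have hn1 : 1 ≤ n := by omega
    have h2 : (n + 1) ^ c' ≤ 2 ^ c' * n ^ c' := by
      rw [← mul_pow]; exact Nat.pow_le_pow_left (by omega) c'
    have h4 : C * 2 ^ c' ≤ n := by rw [mul_comm]; omega
    have h3 : C * (2 ^ c' * n ^ c') ≤ n * n ^ c' := by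
      rw [← mul_assoc]; exact Nat.mul_le_mul_right _ h4
    calc κinf n ≤ C * (n + 1) ^ c' := hC n
      _ ≤ C * (2 ^ c' * n ^ c') := Nat.mul_le_mul_left _ h2
      _ ≤ n * n ^ c' := h3
      _ = n ^ (c' + 1) := by ring
      _ ≤ n ^ max (c' + 1) (C * (2 ^ c' * C + 2) ^ c') := Nat.pow_le_pow_right hn1 (le_max_left _ _)
      _ ≤ _ := Nat.le_add_right _ _

/-- **¬ GradedLaw from the endpoint bound** (the crux, item 11562). -/
theorem not_gradedLaw_of_polyModTriples (h : PolyModTriples) : ¬ GradedLaw := by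
  obtain ⟨c, hc⟩ := fixedExponent_of_polyModTriples h
  exact not_gradedLaw_of_fixedExponent hc

/-- **¬ UniformLaw from the endpoint bound** (the route TARGET, item 11561; route kill criterion `refuted:UniformLaw`). -/
theorem not_uniformLaw_of_polyModTriples (h : PolyModTriples) : ¬ UniformLaw := by
  obtain ⟨c, hc⟩ := fixedExponent_of_polyModTriples h
  exact not_uniformLaw_of_fixedExponent hc

/-! ## Negation: the explicit representative (walk-exponential formula), typed

`walkRep r n` = degree-`n` part of `exp(S) · exp_{<r}(E_r)` where `E_r` collects, with the coefficients of the
walk-exponential formula, the WALK polynomials of the connected shapes with at most `r − 1` degree-2 vertices: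
cycles `Y_k` (`tr((XXᵀ)^k)/(2k)`, `2k ≤ r−1`), even paths from the row / column side (`−½·𝟙ᵀ(XXᵀ)^a𝟙`,
`−½·𝟙ᵀ(XᵀX)^a𝟙`, `2a ≤ r`), odd paths (`+𝟙ᵀ(XXᵀ)^aX𝟙`, `2a ≤ r−1`); the single edge is `S` itself.
Census §1: `walkRep r n − per_n ∈ J_r(n)` for all `r ≥ 1`, `n ≥ 0` (machine-checked `r ≤ 6`, and the closed form
`det(I−XXᵀ)^{−1/2}·exp(S − ½|C|² − ½(R−XC)ᵀ(I−XXᵀ)^{−1}(R−XC)) ≡ Σ_matchings x^M (mod J_∞)` exactly at `n ≤ 4`). -/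

/-- The variable matrix `X = (x_ij)`. -/
def Xmat (n : ℕ) : Matrix (Fin n) (Fin n) (MvPolynomial (Fin n × Fin n) ℂ) := Matrix.of fun i j => X (i, j)

/-- `A = X Xᵀ` (row Gram matrix) and `B = Xᵀ X` (column Gram matrix). -/
def gramR (n : ℕ) : Matrix (Fin n) (Fin n) (MvPolynomial (Fin n × Fin n) ℂ) := Xmat n * (Xmat n).transpose
def gramC (n : ℕ) : Matrix (Fin n) (Fin n) (MvPolynomial (Fin n × Fin n) ℂ) := (Xmat n).transpose * Xmat n

/-- `S = Σ x_ij` (walk polynomial of the single edge). -/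
def Ssum (n : ℕ) : MvPolynomial (Fin n × Fin n) ℂ := ∑ v : Fin n × Fin n, X v

/-- Sum of all entries of a square matrix (`𝟙ᵀ M 𝟙`). -/
def entrySum {n : ℕ} (M : Matrix (Fin n) (Fin n) (MvPolynomial (Fin n × Fin n) ℂ)) :
    MvPolynomial (Fin n × Fin n) ℂ := ∑ i : Fin n, ∑ j : Fin n, M i j

/-- The exponent `E_r` (non-edge connected shapes with ≤ r−1 doubled vertices, walk-exponential coefficients). -/
def shapeExp (r n : ℕ) : MvPolynomial (Fin n × Fin n) ℂ :=
  (∑ k ∈ Finset.Icc 1 ((r - 1) / 2), (1 / (2 * (k : ℂ))) • Matrix.trace (gramR n ^ k))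
  - (1 / 2 : ℂ) • (∑ a ∈ Finset.Icc 1 (r / 2), (entrySum (gramR n ^ a) + entrySum (gramC n ^ a)))
  + (∑ a ∈ Finset.Icc 1 ((r - 1) / 2), entrySum (gramR n ^ a * Xmat n))

/-- `exp_{<r}(E) = Σ_{m<r} E^m/m!` (higher powers lie in `J_r`: every monomial of `E_r` has a doubled line). -/
def expTrunc (r : ℕ) {n : ℕ} (E : MvPolynomial (Fin n × Fin n) ℂ) : MvPolynomial (Fin n × Fin n) ℂ :=
  ∑ m ∈ Finset.range r, (1 / ((m.factorial : ℕ) : ℂ)) • E ^ m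

/-- The walk representative: degree-`n` part of `exp(S) · exp_{<r}(E_r)`. -/
def walkRep (r n : ℕ) : MvPolynomial (Fin n × Fin n) ℂ :=
  ∑ t ∈ Finset.range (n + 1),
    (1 / (((n - t).factorial : ℕ) : ℂ)) •
      (MvPolynomial.homogeneousComponent t (expTrunc r (shapeExp r n)) * Ssum n ^ (n - t))

/-- Sanity read-back at `r = 1`: `walkRep 1 n = S^n/n!` up to the empty sums (PurePowerAnchor / n!). (Stated, not
proved: elaboration check of the shape of the definition.) -/
def WalkRepOne : Prop := ∀ n : ℕ, walkRep 1 n = (1 / ((n.factorial : ℕ) : ℂ)) • Ssum n ^ n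

/-- NegA — THE WALK-EXPONENTIAL FORMULA (to be proved in Theorems; size XL but elementary: component factorisation of
coefficient extraction in `exp(Σ c_K Hom_K)` + three connected computations — paths: compositions, `1/(1 − z/(1+z)) =
1 + z`; simple cycles `C_2k`: `1 + ((1−1)^{2k} − 1) = 0`; the double edge: `½ − ½ − ½ + ½ = 0`; census §1.3). -/
def WalkRepMem : Prop := ∀ r n : ℕ, 1 ≤ r → walkRep r n - perPoly (Fin n) ℂ ∈ J r n

/-- NegB — cost (to be proved in Theorems; size L): matrix products `O(r·n³)`, `r` ring operations for `exp_{<r}`,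
homogeneous-component extraction `O(deg²)` with `deg ≤ r(r+1)`, `n+1` products with powers of `S`; any polynomial
bound in `(r, n)` suffices downstream. -/
def WalkRepCost : Prop := ∃ a b C : ℕ, ∀ r n : ℕ, 1 ≤ r → complexity (walkRep r n) ≤ C * (r + 1) ^ a * (n + 1) ^ b

/-- NegA + NegB ⇒ the endpoint bound, through the rung `r = 2n+1` (`J_(2n+1)(n) = J_∞(n)`). PROVED. -/
theorem polyModTriples_of_walk (hA : WalkRepMem) (hB : WalkRepCost) : PolyModTriples := by
  obtain ⟨a, b, C, hC⟩ := hB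
  refine ⟨a + b, C * 2 ^ a, fun n => ?_⟩
  have h1 : κinf n ≤ complexity (walkRep (2 * n + 1) n) := by
    rw [← κ_eq_κinf n]
    exact cosetComplexity_le_iff_sub_mem.2 ⟨walkRep (2 * n + 1) n, hA _ _ (by omega), le_rfl⟩
  have h2 := hC (2 * n + 1) n (by omega)
  have h3 : (2 * n + 1 + 1) ^ a = 2 ^ a * (n + 1) ^ a := by
    rw [← mul_pow]; congr 1
  calc κinf n ≤ complexity (walkRep (2 * n + 1) n) := h1
    _ ≤ C * (2 * n + 1 + 1) ^ a * (n + 1) ^ b := h2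
    _ = C * 2 ^ a * (n + 1) ^ (a + b) := by rw [h3]; ring

/-- The whole negation chain: NegA → NegB → ¬ GradedLaw (and ¬ UniformLaw, ¬ X∞). PROVED modulo NegA/NegB. -/
theorem not_gradedLaw_of_walk (hA : WalkRepMem) (hB : WalkRepCost) : ¬ GradedLaw :=
  not_gradedLaw_of_polyModTriples (polyModTriples_of_walk hA hB)

theorem not_uniformLaw_of_walk (hA : WalkRepMem) (hB : WalkRepCost) : ¬ UniformLaw :=
  not_uniformLaw_of_polyModTriples (polyModTriples_of_walk hA hB)

theorem not_xInfinity_of_walk (hA : WalkRepMem) (hB : WalkRepCost) : ¬ XInfinity :=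
  not_xInfinity_of_polyModTriples (polyModTriples_of_walk hA hB)

/-! ## Decomposition: the typed seams of census §3 (elaboration only; each has a FALSE or COSTUME piece) -/

/-- D1, the route's own layer-2 plan (card K1): COLLISION AMPLIFICATION — a self-reduction lowering `r` at polynomial
loss, `κ_(r+1)(n + b) ≥ n^γ · κ_r(n) / b`. FALSE given `PolyModTriples` (with the trivial base `κ_1(n) ≥ 1` it would
force `κ_r ≥ n^{γ(r−1) − o(r)}`). -/
def CollisionAmplification : Prop :=
  ∃ γ : ℝ, 0 < γ ∧ ∃ b : ℕ, 1 ≤ b ∧ ∀ r : ℕ, 1 ≤ r → ∃ n₀ : ℕ, ∀ n : ℕ, n₀ ≤ n →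
    (n : ℝ) ^ γ * ((κ r n : ℕ) : ℝ) / b ≤ ((κ (r + 1) (n + b) : ℕ) : ℝ)

/-- D1 base rung (TRUE, trivial: every representative mentions a variable): `κ_1(n) ≥ 1` for `n ≥ 1`. -/
def BaseRung : Prop := ∀ n : ℕ, 1 ≤ n → 1 ≤ κ 1 n

/-- D1 glue (honest induction on `r`, real-exponent bookkeeping; TRUE): amplification + base ⇒ GradedLaw. With
`CollisionAmplification` false the split has a false piece — (a) fails. -/
def AmplifyToGraded : Prop := CollisionAmplification → BaseRung → GradedLaw

/-- D2, rung-wise conjunction: `∀ r, FixedRung γ r` is GradedLaw with the quantifiers commuted as far as they go —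
COSTUME (the pieces are the crux instance by instance; no piece is weaker in kind), and false from `r > 3/γ` on. -/
def FixedRung (γ : ℝ) (r : ℕ) : Prop := ∃ n₀ : ℕ, ∀ n : ℕ, n₀ ≤ n → (n : ℝ) ^ (γ * r) ≤ ((κ r n : ℕ) : ℝ)

/-- D3, model transfer (the sibling census' template, graded): a graded law in a circuit class `M` plus a conversion of
general coset circuits into `M` at polynomial cost. Every instance has a FALSE piece: homogeneous / ABP / bounded-depth
graded laws all fail against `walkRep` (homogeneous, an ABP of width `O(n²)`, depth `O(log r)`·const). -/
def GradedModelLaw (M : ∀ n : ℕ, ArithCircuit ℂ (Fin n × Fin n) → Prop) : Prop :=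
  ∃ γ : ℝ, 0 < γ ∧ ∀ r : ℕ, 1 ≤ r → ∃ n₀ : ℕ, ∀ n : ℕ, n₀ ≤ n →
    ∀ (P : MvPolynomial (Fin n × Fin n) ℂ) (Φ : ArithCircuit ℂ (Fin n × Fin n)),
      P - perPoly (Fin n) ℂ ∈ J r n → M n Φ → Φ.IsFanInTwo → Φ.Computes P → (n : ℝ) ^ (γ * r) ≤ (Φ.size : ℝ)

/-! ## Strengthen: typed S⁺ candidates of census §4 (all FALSE with the crux; the survivors are weaker-model laws) -/

/-- S⁺₁: the graded law with the explicit exponent `γ = 1/2` (the value the syndrome upper bound leaves room for).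
FALSE (`κ_r ≤ C_r n³`). -/
def GradedLawHalf : Prop :=
  ∀ r : ℕ, 1 ≤ r → ∃ n₀ : ℕ, ∀ n : ℕ, n₀ ≤ n → (n : ℝ) ^ ((1 / 2 : ℝ) * r) ≤ ((κ r n : ℕ) : ℝ)

/-- S⁺₂: increment law (each new forgiven collision costs a factor `n^γ`): `κ_(r+1)(n) ≥ n^γ κ_r(n)` eventually.
FALSE (the ladder is eventually flat in the exponent: `κ_r(n) = Θ̃(n²…n³)` for every fixed `r`). -/
def IncrementLaw : Prop :=
  ∃ γ : ℝ, 0 < γ ∧ ∀ r : ℕ, 1 ≤ r → ∃ n₀ : ℕ, ∀ n : ℕ, n₀ ≤ n →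
    (n : ℝ) ^ γ * ((κ r n : ℕ) : ℝ) ≤ ((κ (r + 1) n : ℕ) : ℝ)

/-- Weaker-model survivor (NOT an S⁺ and NOT feeding `closes`: it only gives `VF ≠ VNP`): the graded FORMULA law.
Plausibly true with exponent `Θ(r)` (as a formula `walkRep` costs `n^{Θ(r)}`: iterated matrix products do not share),
but beyond every known formula lower-bound technique from `γ r > 3` on (Kalorkoti's `Ω(n³)` for `det_n` is the ceiling). -/
def GradedFormulaLaw : Prop :=
  ∃ γ : ℝ, 0 < γ ∧ ∀ r : ℕ, 1 ≤ r → ∃ n₀ : ℕ, ∀ n : ℕ, n₀ ≤ n →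
    ∀ P : MvPolynomial (Fin n × Fin n) ℂ, P - perPoly (Fin n) ℂ ∈ J r n →
      (n : ℝ) ^ (γ * r) ≤ ((formulaComplexity P : ℕ) : ℝ)

end Summit.ValiantsHypothesis.ValiantsHypothesis.Cruxes.GradedLaw.Census
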